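import Literature.NumberTheory.Transcendental.RoySmallValueIdealPQ
import Literature.NumberTheory.Transcendental.RoySmallValuePhiNonvanishing
import Mathlib.RingTheory.Nullstellensatz
import HarnessLib

/-!
# Roy's small value estimate for `𝔾ₐ × 𝔾ₘ` — unmixedness of `(P, Q)` and the zeros of `Φ(P, Q, ·)`

Topic `Literature/NumberTheory/Transcendental`. Part of the formalisation of the proof of Roy 2013,
Theorem 1.1 (named fact `roy2013_thm_1_1`, `RoySmallValueEstimates.lean`). Source: D. Roy,
*A small value estimate for `𝔾ₐ × 𝔾ₘ`*, Mathematika 59 (2013) 333–363 = arXiv:1301.0663, §5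
(p. 13) and §6 (proof of Proposition 6.4, p. 17):

> [...] a regular sequence [...] which, for homogeneous polynomials, is equivalent to asking that
> `dim 𝒵(P₁, …, P_t) = m − t`.
> [...] the map `F(R) = Res_D(P, Q, R)` [...] `F(R) = a R(α₁)^{e₁} ⋯ R(α_t)^{e_t}` [...]

We prove the unmixedness statement the paper relies on, for two coprime ternary forms `P, Q` of
degree `D ≥ 1`: **a form `R` with no zero on `𝒵(P, Q)` is a non-zero-divisor modulo `(P, Q)`**
(`mul_mem_span_pair_of_no_common_zero`). Proof: by the projective Nullstellensatz (Mathlib's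
`MvPolynomial.vanishingIdeal_zeroLocus_eq_radical`) `(P, Q, R)` contains all forms of large
degree, so multiplication by `R` on `ℂ[X]/(P, Q)` is onto in large degree, hence one-to-one there
by the dimension count `dim ℂ[X]_ν/(P, Q)_ν = D²` (`RoySmallValueIdealPQ`), and one descends to
every degree with the linear non-zero-divisor of `RoySmallValueLineForms`. Consequences for the
determinant `Φ` (which replaces `Res_D`): the data `(M₁, M₂, σ)` of `Φ` exist for every coprime
pair (`exists_phi_data_of_coprime`), and **`Φ(P, Q, R) = 0` iff `R` has a common zero with
`P, Q`** (`royPhi_eq_zero_iff_common_zero`). Everything here is proved; no named facts.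

## References

* [Roy2013] D. Roy, *A small value estimate for 𝔾ₐ × 𝔾ₘ*, Mathematika 59 (2013), 333–363
  (arXiv:1301.0663), §5 (regular sequences), §6 (proof of Proposition 6.4).
-/

noncomputable section

open MvPolynomial Finset Module

namespace Literature.NumberTheory.Transcendental

namespace Roy2013

variable {D : ℕ}

/-! ### Homogeneous components and the ideal `(P, Q)` -/

/-- `(P, Q)` is a homogeneous ideal: it contains the homogeneous components of its elements.
[folklore] -/
theorem homogeneousComponent_mem_span_pair {P Q g : CX} (hP : P.IsHomogeneous D)
    (hQ : Q.IsHomogeneous D) (hg : g ∈ Ideal.span {P, Q}) (m : ℕ) :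
    homogeneousComponent m g ∈ Ideal.span {P, Q} := by
  classical
  obtain ⟨u, v, rfl⟩ := Ideal.mem_span_pair.mp hg
  have key : ∀ (w F : CX), F.IsHomogeneous D → F ∈ Ideal.span {P, Q} →
      homogeneousComponent m (w * F) ∈ Ideal.span {P, Q} := by
    intro w F hF hFm
    have hw : w * F = ∑ i ∈ range (w.totalDegree + 1), homogeneousComponent i w * F := by
      rw [← Finset.sum_mul, sum_homogeneousComponent]
    rw [hw, map_sum]
    refine Ideal.sum_mem _ fun i _ => ?_
    rw [homogeneousComponent_of_mem ((homogeneousComponent_isHomogeneous i w).mul hF)]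
    split_ifs
    · exact Ideal.mul_mem_left _ _ hFm
    · exact Ideal.zero_mem _
  rw [map_add]
  exact Ideal.add_mem _ (key u P hP (Ideal.subset_span (by simp)))
    (key v Q hQ (Ideal.subset_span (by simp)))

/-- To be in `(P, Q)` it suffices that all homogeneous components are. [folklore] -/
theorem mem_span_pair_of_homogeneousComponent {P Q f : CX}
    (h : ∀ m, homogeneousComponent m f ∈ Ideal.span {P, Q}) : f ∈ Ideal.span {P, Q} := by
  classical
  rw [← sum_homogeneousComponent f]
  exact Ideal.sum_mem _ fun m _ => h m

/-! ### The projective Nullstellensatz for `(P, Q, R)` -/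

/-- If `P, Q, R` have no common projective zero, some power of each variable lies in `(P, Q, R)`.
[cite: Roy2013, §5 (regular sequences); via Mathlib's Nullstellensatz] -/
theorem exists_X_pow_mem_of_no_common_zero {P Q R : CX}
    (hV : ∀ α : Fin 3 → ℂ, α ≠ 0 → eval α P = 0 → eval α Q = 0 → eval α R ≠ 0) :
    ∃ k : ℕ, ∀ i : Fin 3, (X i : CX) ^ k ∈ Ideal.span {P, Q, R} := by
  set J : Ideal CX := Ideal.span {P, Q, R} with hJ
  have hXi : ∀ i : Fin 3, (X i : CX) ∈ J.radical := by
    intro i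
    rw [← MvPolynomial.vanishingIdeal_zeroLocus_eq_radical (K := ℂ), mem_vanishingIdeal_iff]
    intro x hx
    rw [mem_zeroLocus_iff] at hx
    have hP : eval x P = 0 := hx P (Ideal.subset_span (by simp))
    have hQ : eval x Q = 0 := hx Q (Ideal.subset_span (by simp))
    have hR : eval x R = 0 := hx R (Ideal.subset_span (by simp))
    have hx0 : x = 0 := by
      by_contra h0
      exact hV x h0 hP hQ hR
    rw [aeval_X, hx0, Pi.zero_apply]
  choose k hk using fun i => Ideal.mem_radical_iff.mp (hXi i)
  refine ⟨k 0 + k 1 + k 2, fun i => ?_⟩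
  have hle : k i ≤ k 0 + k 1 + k 2 := by fin_cases i <;> simp <;> omega
  rw [← Nat.add_sub_cancel' hle, pow_add]
  exact Ideal.mul_mem_right _ _ (hk i)

/-- Then `(P, Q, R)` contains every form of degree `≥ 3k`. [folklore] -/
theorem mem_span_triple_of_isHomogeneous {P Q R : CX} {k : ℕ}
    (hk : ∀ i : Fin 3, (X i : CX) ^ k ∈ Ideal.span {P, Q, R}) {f : CX} {μ : ℕ}
    (hf : f.IsHomogeneous μ) (hμ : 3 * k ≤ μ) : f ∈ Ideal.span {P, Q, R} := by
  classical
  rw [f.as_sum]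
  refine Ideal.sum_mem _ fun ν hν => ?_
  have hdeg : ν.degree = μ := by
    rw [Finsupp.degree_eq_weight_one]; exact hf (mem_support_iff.mp hν)
  -- some exponent is `≥ k`
  obtain ⟨i, hi⟩ : ∃ i, k ≤ ν i := by
    by_contra h
    have h' : ∀ i, ν i < k := fun i => not_le.mp (not_exists.mp h i)
    rw [Finsupp.degree_eq_sum] at hdeg
    have h3 : ∑ i, ν i < 3 * k := by
      calc ∑ i, ν i = ν 0 + ν 1 + ν 2 := by rw [Fin.sum_univ_three]
        _ < 3 * k := by have := h' 0; have := h' 1; have := h' 2; omega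
    omega
  have hmon : (monomial ν) (coeff ν f) =
      C (coeff ν f) * monomial (ν - Finsupp.single i k) 1 * X i ^ k := by
    rw [X_pow_eq_monomial, C_mul_monomial, monomial_mul, mul_one, mul_one,
      tsub_add_cancel_of_le (Finsupp.single_le_iff.mpr (by simpa using hi))]
  rw [hmon]
  exact Ideal.mul_mem_left _ _ (hk i)

/-! ### Unmixedness -/

/-- **A form with no zero on `𝒵(P, Q)` is a non-zero-divisor modulo `(P, Q)`** (`P, Q` coprime
ternary forms of degree `D ≥ 1`, `R` a form of degree `d`): `Rf ∈ (P, Q) ⇒ f ∈ (P, Q)`.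
[cite: Roy2013, §5 ("equivalent to asking that `dim 𝒵(P₁, …, P_t) = m − t`"); §6, proof of
Proposition 6.4] -/
theorem mul_mem_span_pair_of_no_common_zero {P Q R : CX} {d : ℕ} (hP : P.IsHomogeneous D)
    (hQ : Q.IsHomogeneous D) (hR : R.IsHomogeneous d) (hD : 1 ≤ D) (hP0 : P ≠ 0) (hQ0 : Q ≠ 0)
    (hR0 : R ≠ 0) (hPQ : ∀ f : CX, Q * f ∈ Ideal.span {P} → f ∈ Ideal.span {P})
    (hV : ∀ α : Fin 3 → ℂ, α ≠ 0 → eval α P = 0 → eval α Q = 0 → eval α R ≠ 0)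
    {f : CX} (hf : R * f ∈ Ideal.span {P, Q}) : f ∈ Ideal.span {P, Q} := by
  classical
  obtain ⟨k, hk⟩ := exists_X_pow_mem_of_no_common_zero hV
  obtain ⟨a, b, hVh, hh⟩ := exists_regular_lineForm_pow hP hQ hD hP0 hQ0 hPQ
  -- notation for the pieces of `(P, Q)`
  let W : ℕ → Submodule ℂ CX := fun n =>
    (homogeneousSubmodule (Fin 3) ℂ n).map (LinearMap.mulLeft ℂ P) ⊔
      (homogeneousSubmodule (Fin 3) ℂ n).map (LinearMap.mulLeft ℂ Q)
  have hWmem : ∀ (n : ℕ) (g : CX), g ∈ W n ↔ g.IsHomogeneous (n + D) ∧ g ∈ Ideal.span {P, Q} :=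
    fun n g => mem_map_sup_map_iff hP hQ
  -- Step 1: the homogeneous case in degree `a₀ = 2D + e` with `e ≥ 3k`
  have hstep : ∀ (e : ℕ) (g : CX), 3 * k ≤ e → g.IsHomogeneous (D + D + e) →
      R * g ∈ Ideal.span {P, Q} → g ∈ Ideal.span {P, Q} := by
    intro e g he hg hRg
    set Sa := homogeneousSubmodule (Fin 3) ℂ (D + D + e) with hSa
    set Sμ := homogeneousSubmodule (Fin 3) ℂ (D + D + e + d) with hSμ
    haveI : FiniteDimensional ℂ Sa := finite_homogeneousSubmodule_fin_three _
    haveI : FiniteDimensional ℂ Sμ := finite_homogeneousSubmodule_fin_three _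
    haveI hfa : ∀ n, FiniteDimensional ℂ (W n) := fun n => by
      haveI := finite_homogeneousSubmodule_fin_three n
      haveI : FiniteDimensional ℂ ((homogeneousSubmodule (Fin 3) ℂ n).map (LinearMap.mulLeft ℂ P)) :=
        Module.Finite.map _ _
      haveI : FiniteDimensional ℂ ((homogeneousSubmodule (Fin 3) ℂ n).map (LinearMap.mulLeft ℂ Q)) :=
        Module.Finite.map _ _
      exact Submodule.finiteDimensional_sup _ _
    haveI : FiniteDimensional ℂ (Sa.map (LinearMap.mulLeft ℂ R)) := Module.Finite.map _ _
    -- (i) every form of degree `μ₀ = 2D + e + d` is in `R·S_a + (P, Q)_{μ₀}`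
    have hsurj : Sa.map (LinearMap.mulLeft ℂ R) ⊔ W (D + e + d) = Sμ := by
      apply le_antisymm
      · refine sup_le ?_ ?_
        · rintro _ ⟨u, hu, rfl⟩
          rw [LinearMap.mulLeft_apply]
          have h := hR.mul ((mem_homogeneousSubmodule _ _).mp hu)
          rw [add_comm] at h; exact (mem_homogeneousSubmodule _ _).mpr h
        · intro g' hg'
          have h := ((hWmem _ _).mp hg').1
          rw [show D + e + d + D = D + D + e + d by ring] at h
          exact (mem_homogeneousSubmodule _ _).mpr h
      · intro g' hg'
        have hg'h : g'.IsHomogeneous (D + D + e + d) := (mem_homogeneousSubmodule _ _).mp hg'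
        have hJ := mem_span_triple_of_isHomogeneous hk hg'h (by omega)
        -- `g' = uP + vQ + wR`, then take homogeneous components
        rw [Ideal.mem_span_insert] at hJ
        obtain ⟨u, z, hz, rfl⟩ := hJ
        obtain ⟨v, w, rfl⟩ := Ideal.mem_span_pair.mp hz
        have hdec : u * P + (v * Q + w * R) =
            homogeneousComponent (D + e + d) u * P +
              (homogeneousComponent (D + e + d) v * Q + homogeneousComponent (D + D + e) w * R) := by
          conv_lhs => rw [← if_pos rfl (t := u * P + (v * Q + w * R)),
            ← homogeneousComponent_of_mem hg'h, map_add, map_add,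
            show D + D + e + d = (D + e + d) + D by ring, homogeneousComponent_mul_right hP,
            homogeneousComponent_mul_right hQ, show D + e + d + D = (D + D + e) + d by ring,
            homogeneousComponent_mul_right hR]
        have hmem1 : homogeneousComponent (D + D + e) w * R ∈ Sa.map (LinearMap.mulLeft ℂ R) :=
          ⟨_, (mem_homogeneousSubmodule _ _).mpr (homogeneousComponent_isHomogeneous _ _),
            by rw [LinearMap.mulLeft_apply, mul_comm]⟩
        have hmem2 : homogeneousComponent (D + e + d) u * P + homogeneousComponent (D + e + d) v * Q ∈
            W (D + e + d) := by
          rw [hWmem]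
          refine ⟨?_, Ideal.mem_span_pair.mpr ⟨_, _, rfl⟩⟩
          have hu := (homogeneousComponent_isHomogeneous (D + e + d) u).mul hP
          have hv := (homogeneousComponent_isHomogeneous (D + e + d) v).mul hQ
          exact hu.add hv
        rw [hdec, show ∀ A B C : CX, A + (B + C) = C + (A + B) from fun A B C => by ring]
        exact Submodule.add_mem_sup hmem1 hmem2
    -- (ii) `A = {f ∈ S_a : Rf ∈ (P,Q)_{μ₀}}` has the dimension of `(P,Q)_a`
    set A : Submodule ℂ CX := Sa ⊓ (W (D + e + d)).comap (LinearMap.mulLeft ℂ R) with hA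
    haveI : FiniteDimensional ℂ A := Submodule.finiteDimensional_of_le inf_le_left
    have hinf : Sa.map (LinearMap.mulLeft ℂ R) ⊓ W (D + e + d) = A.map (LinearMap.mulLeft ℂ R) := by
      apply le_antisymm
      · rintro g' ⟨⟨u, hu, rfl⟩, hg'⟩
        exact ⟨u, ⟨hu, hg'⟩, rfl⟩
      · rintro _ ⟨u, ⟨hu, hu'⟩, rfl⟩
        exact ⟨⟨u, hu, rfl⟩, hu'⟩
    have hdim := Submodule.finrank_sup_add_finrank_inf_eq (Sa.map (LinearMap.mulLeft ℂ R))
      (W (D + e + d))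
    rw [hsurj, hinf, hSμ, finrank_homogeneousSubmodule_fin_three,
      LinearEquiv.finrank_eq (Submodule.equivMapOfInjective _ (mul_right_injective₀ hR0) A).symm,
      finrank_map_mulLeft hR0] at hdim
    have h1 := finrank_map_sup_map_add_sq hP hQ hP0 hQ0 hPQ (e + d)
    have h2 := finrank_map_sup_map_add_sq hP hQ hP0 hQ0 hPQ e
    rw [show e + d + D = D + e + d by ring, show e + d + 2 * D + 2 = D + D + e + d + 2 by ring] at h1
    rw [show e + 2 * D + 2 = D + D + e + 2 by ring] at h2
    have hWA : W (D + e) ≤ A := by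
      intro u hu
      obtain ⟨huh, huPQ⟩ := (hWmem _ _).mp hu
      refine ⟨(mem_homogeneousSubmodule _ _).mpr (by rw [show D + D + e = D + e + D by ring]; exact huh), ?_⟩
      change (LinearMap.mulLeft ℂ R) u ∈ W (D + e + d)
      rw [LinearMap.mulLeft_apply, hWmem]
      refine ⟨?_, Ideal.mul_mem_left _ _ huPQ⟩
      have h := hR.mul huh
      rwa [show d + (D + e + D) = D + e + d + D by ring] at h
    have hAeq : W (D + e) = A := by
      refine Submodule.eq_of_le_of_finrank_eq hWA ?_
      change finrank ℂ ↥(W (D + e + d)) + D ^ 2 = _ at h1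
      change finrank ℂ ↥(W (e + D)) + D ^ 2 = _ at h2
      rw [show e + D = D + e by ring] at h2
      omega
    -- (iii) conclude for `g`
    have hgA : g ∈ A := by
      refine ⟨(mem_homogeneousSubmodule _ _).mpr hg, ?_⟩
      change (LinearMap.mulLeft ℂ R) g ∈ W (D + e + d)
      rw [LinearMap.mulLeft_apply, hWmem]
      refine ⟨?_, hRg⟩
      have h := hR.mul hg
      rwa [show d + (D + D + e) = D + e + d + D by ring] at h
    rw [← hAeq] at hgA
    exact ((hWmem _ _).mp hgA).2
  -- Step 2: any homogeneous `f`, by multiplying with a power of the linear non-zero-divisor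
  have hhom : ∀ (ν : ℕ) (g : CX), g.IsHomogeneous ν → R * g ∈ Ideal.span {P, Q} →
      g ∈ Ideal.span {P, Q} := by
    intro ν g hg hRg
    refine hh (D + D + 3 * k) g (hstep (3 * k + ν) _ (by omega) ?_ ?_)
    · have h1 : (lineForm a b ^ (D + D + 3 * k)).IsHomogeneous (D + D + 3 * k) := by
        have h := (((isHomogeneous_X ℂ (0 : Fin 3)).sub
          (((isHomogeneous_X ℂ (1 : Fin 3)).C_mul a).add ((isHomogeneous_X ℂ (2 : Fin 3)).C_mul b))).pow
          (D + D + 3 * k))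
        rw [one_mul] at h
        exact h
      have h := h1.mul hg
      rwa [show D + D + 3 * k + ν = D + D + (3 * k + ν) by ring] at h
    · rw [mul_left_comm]
      exact Ideal.mul_mem_left _ _ hRg
  -- Step 3: general `f` through its homogeneous components
  refine mem_span_pair_of_homogeneousComponent fun m => hhom m _
    (homogeneousComponent_isHomogeneous m f) ?_
  have h := homogeneousComponent_mem_span_pair hP hQ hf (m + d)
  rwa [mul_comm, homogeneousComponent_mul_right hR, mul_comm] at h

/-! ### Consequences for `Φ` -/

/-- **The data of `Φ` exist for every coprime pair** `P, Q` of ternary forms of degree `D ≥ 1`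
(a regular third form is supplied by `exists_regular_lineForm_pow`).
[cite: Roy2013, §5, Lemma 5.1 and proof of Theorem 5.2] -/
theorem exists_phi_data_of_coprime {P Q : CX} (hP : P.IsHomogeneous D) (hQ : Q.IsHomogeneous D)
    (hD : 1 ≤ D) (hP0 : P ≠ 0) (hQ0 : Q ≠ 0)
    (hPQ : ∀ f : CX, Q * f ∈ Ideal.span {P} → f ∈ Ideal.span {P}) :
    ∃ M₁ M₂ : Finset (Fin 3 →₀ ℕ), (∀ μ ∈ M₁, μ.degree = 2 * D) ∧ (∀ μ ∈ M₂, μ.degree = 2 * D) ∧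
      Submodule.span ℂ ((fun μ => monomial μ (1 : ℂ)) '' (M₁ : Set (Fin 3 →₀ ℕ))) ⊓
        (homogeneousSubmodule (Fin 3) ℂ D).map (LinearMap.mulLeft ℂ P) = ⊥ ∧
      Submodule.span ℂ ((fun μ => monomial μ (1 : ℂ)) '' (M₁ : Set (Fin 3 →₀ ℕ))) ⊔
        (homogeneousSubmodule (Fin 3) ℂ D).map (LinearMap.mulLeft ℂ P) =
        homogeneousSubmodule (Fin 3) ℂ (2 * D) ∧
      Submodule.span ℂ ((fun μ => monomial μ (1 : ℂ)) '' (M₂ : Set (Fin 3 →₀ ℕ))) ⊓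
        ((homogeneousSubmodule (Fin 3) ℂ D).map (LinearMap.mulLeft ℂ P) ⊔
          (homogeneousSubmodule (Fin 3) ℂ D).map (LinearMap.mulLeft ℂ Q)) = ⊥ ∧
      Submodule.span ℂ ((fun μ => monomial μ (1 : ℂ)) '' (M₂ : Set (Fin 3 →₀ ℕ))) ⊔
        ((homogeneousSubmodule (Fin 3) ℂ D).map (LinearMap.mulLeft ℂ P) ⊔
          (homogeneousSubmodule (Fin 3) ℂ D).map (LinearMap.mulLeft ℂ Q)) =
        homogeneousSubmodule (Fin 3) ℂ (2 * D) ∧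
      Nonempty ((↥(finsuppAntidiag (univ : Finset (Fin 3)) (2 * D)) ⊕ (↥M₁ ⊕ ↥M₂)) ≃
        ↥(finsuppAntidiag (univ : Finset (Fin 3)) (3 * D))) := by
  obtain ⟨a, b, -, hh⟩ := exists_regular_lineForm_pow hP hQ hD hP0 hQ0 hPQ
  have hR : (lineForm a b ^ D).IsHomogeneous D := by
    have h := (((isHomogeneous_X ℂ (0 : Fin 3)).sub
      (((isHomogeneous_X ℂ (1 : Fin 3)).C_mul a).add ((isHomogeneous_X ℂ (2 : Fin 3)).C_mul b))).pow D)
    rw [one_mul] at h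
    exact h
  exact exists_phi_data hP hQ hR hP0 hQ0 hPQ (hh D)

/-- **Two ternary forms of degree `D ≥ 1` have a common projective zero** (from the Hilbert
function: otherwise `(P, Q)` would contain all forms of large degree, but `ℂ[X]_ν/(P,Q)_ν` has
dimension `D² ≥ 1`). [cite: Roy2013, §6, proof of Proposition 6.4 ("`𝒵(P, Q)` has dimension `0`");
elementary] -/
theorem exists_common_zero {P Q : CX} (hP : P.IsHomogeneous D) (hQ : Q.IsHomogeneous D)
    (hD : 1 ≤ D) (hP0 : P ≠ 0) (hQ0 : Q ≠ 0)
    (hPQ : ∀ f : CX, Q * f ∈ Ideal.span {P} → f ∈ Ideal.span {P}) :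
    ∃ α : Fin 3 → ℂ, α ≠ 0 ∧ eval α P = 0 ∧ eval α Q = 0 := by
  by_contra hne
  have hV : ∀ α : Fin 3 → ℂ, α ≠ 0 → eval α P = 0 → eval α Q = 0 → eval α P ≠ 0 :=
    fun α hα h1 h2 _ => hne ⟨α, hα, h1, h2⟩
  obtain ⟨k, hk⟩ := exists_X_pow_mem_of_no_common_zero hV
  have hle : Ideal.span {P, Q, P} ≤ Ideal.span ({P, Q} : Set CX) :=
    Ideal.span_le.mpr (by
      intro x hx
      simp only [Set.mem_insert_iff, Set.mem_singleton_iff] at hx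
      rcases hx with rfl | rfl | rfl
      · exact Ideal.subset_span (by simp)
      · exact Ideal.subset_span (by simp)
      · exact Ideal.subset_span (by simp))
  -- all forms of degree `3k + 2D` lie in `(P, Q)`
  set W := (homogeneousSubmodule (Fin 3) ℂ (3 * k + D)).map (LinearMap.mulLeft ℂ P) ⊔
    (homogeneousSubmodule (Fin 3) ℂ (3 * k + D)).map (LinearMap.mulLeft ℂ Q) with hW
  have hWtop : W = homogeneousSubmodule (Fin 3) ℂ (3 * k + D + D) := by
    apply le_antisymm
    · intro g hg
      exact (mem_homogeneousSubmodule _ _).mpr ((mem_map_sup_map_iff hP hQ).mp hg).1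
    · intro g hg
      have hgh := (mem_homogeneousSubmodule _ _).mp hg
      exact (mem_map_sup_map_iff hP hQ).mpr ⟨hgh,
        hle (mem_span_triple_of_isHomogeneous hk hgh (by omega))⟩
  have h1 := finrank_map_sup_map_add_sq hP hQ hP0 hQ0 hPQ (3 * k)
  rw [← hW, hWtop, finrank_homogeneousSubmodule_fin_three,
    show 3 * k + D + D = 3 * k + 2 * D by ring] at h1
  have hD2 : 1 ≤ D ^ 2 := Nat.one_le_pow _ _ hD
  omega

/-- **`Φ(P, Q, R) = 0` iff `R` has a common zero with `P` and `Q`** (`P, Q` coprime ternary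
forms of degree `D ≥ 1`, `R ∈ ℂ[X]_D`, `Φ` built on complements as in Lemma 5.1).
[cite: Roy2013, §2 ("whose zeros are the tuples having a common zero on `Z`") and §6, proof of
Proposition 6.4 (applied to `Res_D(P, Q, ·)`); here for `Φ`] -/
theorem royPhi_eq_zero_iff_common_zero {M₁ M₂ : Finset (Fin 3 →₀ ℕ)} {P Q R : CX}
    (hP : P.IsHomogeneous D) (hQ : Q.IsHomogeneous D) (hR : R.IsHomogeneous D) (hD : 1 ≤ D)
    (hP0 : P ≠ 0) (hQ0 : Q ≠ 0)
    (hPQ : ∀ f : CX, Q * f ∈ Ideal.span {P} → f ∈ Ideal.span {P})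
    (hM₁ : ∀ μ ∈ M₁, μ.degree = 2 * D) (hM₂ : ∀ μ ∈ M₂, μ.degree = 2 * D)
    (hE₁i : Submodule.span ℂ ((fun μ => monomial μ (1 : ℂ)) '' (M₁ : Set (Fin 3 →₀ ℕ))) ⊓
      (homogeneousSubmodule (Fin 3) ℂ D).map (LinearMap.mulLeft ℂ P) = ⊥)
    (hE₁s : Submodule.span ℂ ((fun μ => monomial μ (1 : ℂ)) '' (M₁ : Set (Fin 3 →₀ ℕ))) ⊔
      (homogeneousSubmodule (Fin 3) ℂ D).map (LinearMap.mulLeft ℂ P) =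
      homogeneousSubmodule (Fin 3) ℂ (2 * D))
    (hE₂i : Submodule.span ℂ ((fun μ => monomial μ (1 : ℂ)) '' (M₂ : Set (Fin 3 →₀ ℕ))) ⊓
      ((homogeneousSubmodule (Fin 3) ℂ D).map (LinearMap.mulLeft ℂ P) ⊔
        (homogeneousSubmodule (Fin 3) ℂ D).map (LinearMap.mulLeft ℂ Q)) = ⊥)
    (hE₂s : Submodule.span ℂ ((fun μ => monomial μ (1 : ℂ)) '' (M₂ : Set (Fin 3 →₀ ℕ))) ⊔
      ((homogeneousSubmodule (Fin 3) ℂ D).map (LinearMap.mulLeft ℂ P) ⊔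
        (homogeneousSubmodule (Fin 3) ℂ D).map (LinearMap.mulLeft ℂ Q)) =
      homogeneousSubmodule (Fin 3) ℂ (2 * D))
    (σ : (↥(finsuppAntidiag (univ : Finset (Fin 3)) (2 * D)) ⊕ (↥M₁ ⊕ ↥M₂)) ≃
      ↥(finsuppAntidiag (univ : Finset (Fin 3)) (3 * D))) :
    royPhi D M₁ M₂ σ ![P, Q, R] = 0 ↔
      ∃ α : Fin 3 → ℂ, α ≠ 0 ∧ eval α P = 0 ∧ eval α Q = 0 ∧ eval α R = 0 := by
  constructor
  · intro h0
    by_contra hV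
    have hV' : ∀ α : Fin 3 → ℂ, α ≠ 0 → eval α P = 0 → eval α Q = 0 → eval α R ≠ 0 :=
      fun α hα h1 h2 h3 => hV ⟨α, hα, h1, h2, h3⟩
    have hR0 : R ≠ 0 := by
      intro hR0
      obtain ⟨α, hα, h1, h2⟩ := exists_common_zero hP hQ hD hP0 hQ0 hPQ
      exact hV' α hα h1 h2 (by rw [hR0, map_zero])
    exact royPhi_ne_zero hP hQ hR hP0 hQ0 hPQ
      (fun f hf => mul_mem_span_pair_of_no_common_zero hP hQ hR hD hP0 hQ0 hR0 hPQ hV' hf)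
      hM₁ hM₂ hE₁i hE₁s hE₂i hE₂s σ h0
  · rintro ⟨α, hα, h1, h2, h3⟩
    exact royPhi_eq_zero_of_common_zero hM₁ hM₂ σ
      (Fin.forall_fin_succ.mpr ⟨hP, Fin.forall_fin_two.mpr ⟨hQ, hR⟩⟩) hα
      (Fin.forall_fin_succ.mpr ⟨h1, Fin.forall_fin_two.mpr ⟨h2, h3⟩⟩)

end Roy2013

end Literature.NumberTheory.Transcendental
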